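import Mathlib.Order.Filter.AtTopBot.Basic
import Mathlib.Topology.Order.Basic
import Mathlib.Analysis.SpecialFunctions.Pow.Real
import Mathlib.MeasureTheory.Function.LpSeminorm.Basic
import Literature.Analysis.FluidPDE.AnomalousDissipation
import HarnessLib

/-!
# Enhanced dissipation at the Sobolev threshold for forced Navier–Stokes on `T³`
  (Bruè–De Lellis 2023, §1, Theorem 1.2)

Topic `Analysis/FluidPDE`, the second main theorem of the source of **turb.S10**
(`brue_deLellis_anomalous_dissipation` = Thm. 1.1, file `AnomalousDissipation.lean`, whose vocabulary
`T3`, `R3`, `IsVanishingViscosity`, `Torus.IsClassicalNSSolutionOn`, `Torus.cumulativeDissipation` is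
reused, never redeclared).

E. Bruè, C. De Lellis, *Anomalous dissipation for the forced 3D Navier–Stokes equations*, Comm. Math.
Phys. 400 (2023) 1507–1533 = arXiv:2207.06301 (v1, the only arXiv version; held as
`paper:arxiv-2207.06301`). Locators are those of the arXiv v1 PDF (page-confirmed 2026-08-26), p. 3:
the force bounds (1.3) `sup_m ‖f^{ν_m}‖_{C([0,1];C^α(T³))} < ∞ for all α ∈ (0,1)` and
(1.4) `sup_m ‖f^{ν_m}‖_{C([0,1];W^{1,p}(T³))} < ∞ for all p < ∞`, Theorem 1.1 (anomalous dissipation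
(1.5) under (1.3); in the tree: `brue_deLellis_anomalous_dissipation`) and **Theorem 1.2** (under (1.4):
no anomalous dissipation is claimed, but the dissipation decays slower than any power of `ν_m`, (1.8)).
Source, p. 3: "If we approach the threshold `C¹` on the Sobolev side, we cannot show (1.2) [the
anomalous dissipation `liminf_{ν→0} ν∫₀ᵀ‖∇u^ν‖²_{L²} > 0`, p. 2] but we can prove a rather strong form of
enhanced dissipation."

## Contents

* `BrueDeLellis2023_enhancedDissipation` — **named fact** (Theorem 1.2 as printed, `def … : Prop`).

## Design choices (faithfulness notes)

* As in `brue_deLellis_anomalous_dissipation`: viscosities `ν : ℕ → ℝ` with `IsVanishingViscosity ν`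
  (strictly decreasing, positive, `→ 0`; the printed `ν_m ↓ 0`), here additionally `ν m < 1` for all
  `m` (pass to a tail; it makes `log(1/ν_m) > 0`, so that the printed `log^{2/3}(1/ν_m)`, typed with
  `Real.rpow`, is the honest power and never a junk value); one smooth datum `u₀`; smooth forces `f m` on
  `[0,1] × T³`; classical solutions `(u m, p m)` on `[0,1]` (`Torus.IsClassicalNSSolutionOn (Icc 0 1)`),
  `u m 0 = u₀`, and — recorded this time, as printed — uniqueness of the velocity among classical
  solutions with the same datum.
* (1.4), `sup_m ‖f^{ν_m}‖_{C([0,1];W^{1,p}(T³))} < ∞ for all p < ∞`: for each `p ∈ [1,∞)` a uniform bound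
  on `‖f_m(t)‖_{L^p} + ∑ᵢ ‖∂ᵢ f_m(t)‖_{L^p}` over `m` and `t ∈ [0,1]` (Mathlib's `eLpNorm` on `T3` and the
  classical `Torus.partialDeriv`; this is the `W^{1,p}` norm of the smooth slice up to the dimensional
  equivalence constant between `∑ᵢ‖∂ᵢ·‖_p` and `‖∇·‖_p`, immaterial for a uniform bound). The continuity of
  `t ↦ f_m(t)` into `W^{1,p}` implicit in "`C([0,1];W^{1,p})`" is automatic for `f_m ∈ C^∞([0,1] × T³)`
  and is not restated.
* (1.8): `ν_m ∫₀¹∫_{T³} |∇u^{ν_m}|² dx dt ≥ C exp{−log^{2/3}(1/ν_m)}` "for some constant `C` independent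
  of `m`", typed with `0 < C` (the content of the bound) and
  `Torus.cumulativeDissipation (ν m) (u m) 0 1 = ν_m ∫₀¹ ‖∇u_m(t)‖₂² dt`.
* NOT vendored: the consequence (1.9) (`≥ C(θ) ν_m^θ` for every `θ > 0`, elementary from (1.8)), and the
  §2 commentary (the limits are smooth forced Euler solutions on `[0,1)`).

## References

* E. Bruè, C. De Lellis, Comm. Math. Phys. 400 (2023) 1507–1533, arXiv:2207.06301v1: Thm. 1.2 p. 3 with
  (1.4) and (1.8). [`BrueDeLellisCMP2023`]
-/

open MeasureTheory Set Filter Topology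
open scoped NNReal ENNReal

noncomputable section

namespace Literature.Analysis.FluidPDE

section BrueDeLellisEnhanced

/-- **Bruè–De Lellis, Theorem 1.2** (Comm. Math. Phys. 400 (2023); arXiv:2207.06301v1 p. 3), verbatim:
"There exist `ν_m ↓ 0`, `f^{ν_m} ∈ C^∞(T³ × [0,1])`, and `u₀^{ν_m} ≡ u₀ ∈ C^∞(T³)` such that (1.4)
[`sup_m ‖f^{ν_m}‖_{C([0,1];W^{1,p}(T³))} < ∞` for all `p < ∞`] holds and for which there is a unique
smooth solution `u^{ν_m} ∈ C^∞(T³ × [0,1])` [of (NS) with viscosity `ν_m`, force `f^{ν_m}`, datum `u₀`]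
with the property that `ν_m ∫₀¹∫_{T³} |∇u^{ν_m}(x,t)|² dx dt ≥ C exp{−log^{2/3}(1/ν_m)}`, (1.8) for some
constant `C` independent of `m`." ("In the latter case, the energy dissipation rate per unit mass
decreases slower than any power law", (1.9).) Rendering: see the module docstring — `IsVanishingViscosity ν`
with `ν m < 1`; (1.4) as uniform bounds on `‖f_m(t)‖_{L^p} + ∑ᵢ ‖∂ᵢ f_m(t)‖_{L^p}`, `p ∈ [1,∞)`; classical
solutions on `[0,1]` from `u₀`, velocity unique; (1.8) with `0 < C` and `Torus.cumulativeDissipation`.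
[cite: BrueDeLellisCMP2023, Thm. 1.2 p. 3 (arXiv:2207.06301v1); (1.4), (1.8)] -/
def BrueDeLellis2023_enhancedDissipation : Prop :=
  ∃ (ν : ℕ → ℝ) (u₀ : T3 → R3) (f u : ℕ → ℝ → T3 → R3) (p : ℕ → ℝ → T3 → ℝ),
    IsVanishingViscosity ν ∧ (∀ m, ν m < 1) ∧ FunctionSpaces.Torus.IsSmooth u₀ ∧
    (∀ m, FunctionSpaces.Torus.IsSmoothSpaceTimeOn (Icc 0 1) (f m)) ∧
    -- (1.4): uniform `C([0,1]; W^{1,p}(T³))` bounds for every finite `p ≥ 1`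
    (∀ q : ℝ≥0, 1 ≤ q →
      ∃ C : ℝ≥0∞, C < ∞ ∧ ∀ m, ∀ t ∈ Icc (0 : ℝ) 1,
        eLpNorm (f m t) (q : ℝ≥0∞) volume +
          ∑ i : Fin 3, eLpNorm (FunctionSpaces.Torus.partialDeriv i (f m t)) (q : ℝ≥0∞) volume ≤ C) ∧
    -- the unique classical solution from `u₀`, for each `m`
    (∀ m, FunctionSpaces.Torus.IsClassicalNSSolutionOn (Icc 0 1) (ν m) (f m) (u m) (p m) ∧ u m 0 = u₀ ∧
      ∀ (w : ℝ → T3 → R3) (q : ℝ → T3 → ℝ),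
        FunctionSpaces.Torus.IsClassicalNSSolutionOn (Icc 0 1) (ν m) (f m) w q → w 0 = u₀ →
          ∀ t ∈ Icc (0 : ℝ) 1, w t = u m t) ∧
    -- (1.8): enhanced dissipation, slower than any power of `ν_m`
    ∃ C : ℝ, 0 < C ∧ ∀ m,
      C * Real.exp (-(Real.log (1 / ν m)) ^ (2 / 3 : ℝ)) ≤
        FunctionSpaces.Torus.cumulativeDissipation (ν m) (u m) 0 1

end BrueDeLellisEnhanced

end Literature.Analysis.FluidPDE

end
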